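import Literature.Probability.Percolation.TallStep
import HarnessLib

/-!
# The tall gait, X: layout arithmetic and absolute positions of the segments

Topic: `Literature/Probability/Percolation`. Quantitative consequences of the invariant `TallInv` of
the plan of the block construction (Grimmett, *Percolation*, 2nd ed. (1999), §7.3, Lemma (7.52)):
the linear inequalities between the layout constants (`TallLayout.OK.facts`), the relation between
the source cell, the target cell and their lanes (`ctr_tgtCell`, `lane_tgtCell`), and absolute
bounds on the base centres of the bricks of each segment in terms of the token's position.

## References

* G. Grimmett, *Percolation*, 2nd ed., Springer 1999, §7.3 pp. 170–174.
-/

noncomputable section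

namespace Literature.Probability.Percolation

open LatticeModels Contour
open scoped Classical

namespace BGNd

variable {d : ℕ} [NeZero d]

namespace TallLayout

variable {Y : TallLayout}

/-- **The layout inequalities**, linearised: with the atoms `ℓ, Pℓ, P²ℓ, P³ℓ, L', m` every bound
used below is linear. [folklore] -/
theorem OK.facts (h : Y.OK) :
    0 ≤ Y.Lp ∧ Y.Lp + 1 ≤ (Y.P : ℤ) * Y.ell ∧ (Y.L : ℤ) = Y.Lp + Y.m + 1 ∧ (Y.H : ℤ) + 1 = Y.ell ∧
      2 * (Y.m : ℤ) + 2 ≤ Y.H ∧ (8 : ℤ) ≤ Y.P ∧ (Y.Pw : ℤ) = 4 * Y.P + 4 ∧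
      Y.Δw ≤ 4 * ((Y.P : ℤ) ^ 2 * Y.ell) + 4 * ((Y.P : ℤ) * Y.ell) ∧ 0 ≤ Y.Δw ∧
      Y.ρv = Y.ell + Y.Lp ∧ Y.ρp = 4 * Y.ell + 4 * Y.Δw + 4 * Y.Lp ∧
      Y.lam = 256 * ((Y.P : ℤ) ^ 2 * Y.ell) ∧ Y.lamJ = 64 * ((Y.P : ℤ) ^ 2 * Y.ell) ∧ Y.Wl = 16 * ((Y.P : ℤ) ^ 2 * Y.ell) ∧
      Y.Dh = 1024 * ((Y.P : ℤ) ^ 3 * Y.ell) ∧ (Y.N₁ : ℤ) = 128 * (Y.P : ℤ) ^ 2 + 8 ∧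
      8 * (Y.ell : ℤ) ≤ (Y.P : ℤ) * Y.ell ∧ 8 * ((Y.P : ℤ) * Y.ell) ≤ (Y.P : ℤ) ^ 2 * Y.ell ∧
      8 * ((Y.P : ℤ) ^ 2 * Y.ell) ≤ (Y.P : ℤ) ^ 3 * Y.ell ∧ (Y.N₁ : ℤ) * Y.Lp ≤ 128 * ((Y.P : ℤ) ^ 3 * Y.ell) + 8 * ((Y.P : ℤ) * Y.ell) ∧
      8 * (Y.P : ℤ) ^ 2 ≤ (Y.P : ℤ) ^ 3 ∧ (64 : ℤ) ≤ (Y.P : ℤ) ^ 2 ∧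
      (Y.Pw : ℤ) * Y.ell = 4 * ((Y.P : ℤ) * Y.ell) + 4 * Y.ell ∧ 0 < Y.Rmax := by
  obtain ⟨hL, hH, htall, hP⟩ := h
  have hell : (Y.ell : ℤ) = Y.H + 1 := by unfold ell; push_cast; ring
  have hLp : Y.Lp = (Y.L : ℤ) - Y.m - 1 := rfl
  have hPw : (Y.Pw : ℤ) = 4 * Y.P + 4 := by unfold Pw; push_cast; ring
  have hΔ : Y.Δw = Y.Pw * Y.Lp := rfl
  have hP' : (8 : ℤ) ≤ Y.P := by exact_mod_cast hP
  have hH0 : (0 : ℤ) ≤ Y.H := by positivity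
  have hell1 : (1 : ℤ) ≤ Y.ell := by rw [hell]; omega
  have hLp0 : 0 ≤ Y.Lp := by rw [hLp]; omega
  have hLpP : Y.Lp + 1 ≤ (Y.P : ℤ) * Y.ell := by rw [hLp]; linarith
  have hPe : 8 * (Y.ell : ℤ) ≤ (Y.P : ℤ) * Y.ell := by nlinarith
  have hP2 : 8 * ((Y.P : ℤ) * Y.ell) ≤ (Y.P : ℤ) ^ 2 * Y.ell := by nlinarith
  have hP3 : 8 * ((Y.P : ℤ) ^ 2 * Y.ell) ≤ (Y.P : ℤ) ^ 3 * Y.ell := by nlinarith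
  have hΔw : Y.Δw ≤ 4 * ((Y.P : ℤ) ^ 2 * Y.ell) + 4 * ((Y.P : ℤ) * Y.ell) := by
    rw [hΔ, hPw]
    have : (4 * (Y.P : ℤ) + 4) * Y.Lp ≤ (4 * (Y.P : ℤ) + 4) * ((Y.P : ℤ) * Y.ell) :=
      mul_le_mul_of_nonneg_left (by linarith) (by positivity)
    linarith
  have hN : (Y.N₁ : ℤ) = 128 * (Y.P : ℤ) ^ 2 + 8 := by unfold N₁; push_cast; ring
  have hNL : (Y.N₁ : ℤ) * Y.Lp ≤ 128 * ((Y.P : ℤ) ^ 3 * Y.ell) + 8 * ((Y.P : ℤ) * Y.ell) := by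
    rw [hN]
    have : (128 * (Y.P : ℤ) ^ 2 + 8) * Y.Lp ≤ (128 * (Y.P : ℤ) ^ 2 + 8) * ((Y.P : ℤ) * Y.ell) :=
      mul_le_mul_of_nonneg_left (by linarith) (by positivity)
    nlinarith
  have hDh : Y.Dh = 1024 * ((Y.P : ℤ) ^ 3 * Y.ell) := by unfold Dh; ring
  have hlam : Y.lam = 256 * ((Y.P : ℤ) ^ 2 * Y.ell) := by unfold lam; ring
  have hlamJ : Y.lamJ = 64 * ((Y.P : ℤ) ^ 2 * Y.ell) := by unfold lamJ; ring
  have hWl : Y.Wl = 16 * ((Y.P : ℤ) ^ 2 * Y.ell) := by unfold Wl; ring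
  refine ⟨hLp0, hLpP, by rw [hLp]; ring, by rw [hell], by exact_mod_cast hH, hP', hPw, hΔw,
    by rw [hΔ]; exact mul_nonneg (by positivity) hLp0,
    rfl, rfl, hlam, hlamJ, hWl, hDh, hN, hPe, hP2, hP3, hNL, by nlinarith, by nlinarith, by rw [hPw]; ring, ?_⟩
  unfold Rmax; have : 0 < Y.P := by omega
  positivity

end TallLayout

/-! ## Cells and lanes -/

section Cells

variable (Y : TallLayout) (a : Site 2) (e : MDir)

omit [NeZero d] in
/-- The step of a macro-direction in coordinates. [folklore] -/
theorem stepVec_apply (e : MDir) (i : Fin 2) : stepVec e i = if i = e.1 then (sgOf e : ℤ) else 0 := by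
  unfold stepVec sgOf
  by_cases hi : i = e.1
  · subst hi; cases e.2 <;> simp
  · have : (Pi.single e.1 (1 : ℤ) : Site 2) i = 0 := Pi.single_eq_of_ne hi _
    cases h2 : e.2 <;> simp [hi]

omit [NeZero d] in
/-- The centre of the target cell along `e`: one cell further. [folklore] -/
theorem ctr_tgtCell_fst : Y.ctr (tgtCell a e) e.1 = Y.ctr a e.1 + (sgOf e : ℤ) * (2 * Y.Dh) := by
  unfold TallLayout.ctr tgtCell
  rw [Pi.add_apply, stepVec_apply, if_pos rfl]; ring

omit [NeZero d] in
/-- The centre of the target cell across `e`: unchanged. [folklore] -/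
theorem ctr_tgtCell_snd : Y.ctr (tgtCell a e) ⟨1 - e.1.val, by have := e.1.isLt; omega⟩ = Y.ctr a ⟨1 - e.1.val, by have := e.1.isLt; omega⟩ := by
  unfold TallLayout.ctr tgtCell
  rw [Pi.add_apply, stepVec_apply, if_neg]
  · ring
  · intro h; have := congrArg Fin.val h; simp at this; have := e.1.isLt; omega

omit [NeZero d] in
/-- The parity flips between a cell and its neighbour. [folklore] -/
theorem cpar_tgtCell : TallLayout.cpar (tgtCell a e) = 1 - TallLayout.cpar a := by
  unfold TallLayout.cpar tgtCell
  simp only [Pi.add_apply, stepVec_apply]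
  have h01 : ((0 : Fin 2) = e.1) ∨ ((1 : Fin 2) = e.1) := by
    rcases Fin.eq_zero_or_eq_succ e.1 with h | ⟨j, hj⟩
    · exact Or.inl h.symm
    · right; rw [hj]; exact congrArg Fin.succ (Fin.fin_one_eq_zero j).symm |>.trans rfl
  have hs : (sgOf e : ℤ) = 1 ∨ (sgOf e : ℤ) = -1 := by rcases Int.units_eq_one_or (sgOf e) with h | h <;> simp [h]
  rcases h01 with h | h <;> rcases hs with hs | hs <;>
    simp only [← h, ↓reduceIte, show ((1 : Fin 2) = 0) = False by decide, show ((0 : Fin 2) = 1) = False by decide, hs] <;> omega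

omit [NeZero d] in
/-- **The trunk lane of the target cell is the entry lane shifted by `v Λ_J`.** [folklore] -/
theorem lane_tgtCell : Y.lane (tgtCell a e) e = Y.lane a e + (jogDir a e : ℤ) * Y.lamJ := by
  unfold TallLayout.lane jogDir
  rw [ctr_tgtCell_snd, cpar_tgtCell]
  have hp : TallLayout.cpar a = 0 ∨ TallLayout.cpar a = 1 := by
    unfold TallLayout.cpar; omega
  rcases hp with h | h <;> simp [h]

end Cells

/-! ## Counting forced steps -/

section Counts

variable (Y : TallLayout) (e : MDir)

/-- At most `P'` riser steps are forced before the turn. [folklore] -/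
theorem nForcedR_le (n k : ℕ) (hk : k ≤ n) : nForcedR Y n k ≤ Y.Pw := by
  have : ∀ k, nForcedR Y n k ≤ k - (n - Y.Pw) := by
    intro k
    induction k with
    | zero => simp
    | succ k ih => rw [nForcedR_succ]; split_ifs with h <;> omega
  have := this k; omega

/-- At most `4P'` trunk steps are forced. [folklore] -/
theorem nForced_le (n₁ n₂ k : ℕ) : nForced Y e n₁ n₂ k ≤ 4 * Y.Pw := by
  have : ∀ k, nForced Y e n₁ n₂ k ≤ min (k - (n₁ - Y.Pw)) (2 * Y.Pw) + min (k - (n₂ - Y.Pw)) (2 * Y.Pw) := by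
    intro k
    induction k with
    | zero => simp
    | succ k ih =>
      rw [nForced_succ]
      by_cases h : trunkForce Y e n₁ n₂ k ≠ 0
      · rw [if_pos h]
        have hk : (k < n₁ ∧ n₁ ≤ k + Y.Pw) ∨ (n₁ ≤ k ∧ k < n₁ + Y.Pw) ∨ (k < n₂ ∧ n₂ ≤ k + Y.Pw) ∨ (n₂ ≤ k ∧ k < n₂ + Y.Pw) := by
          by_contra hno
          apply h
          unfold trunkForce
          simp only
          rw [if_neg (fun h' => hno (Or.inl h')), if_neg (fun h' => hno (Or.inr (Or.inl h'))),
            if_neg (fun h' => hno (Or.inr (Or.inr (Or.inl h')))), if_neg (fun h' => hno (Or.inr (Or.inr (Or.inr h'))))]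
        rcases hk with hk | hk | hk | hk <;> omega
      · rw [if_neg h]; omega
  have := this k; omega

/-- No trunk step before the first window is forced. [folklore] -/
theorem nForced_eq_zero {n₁ n₂ k : ℕ} (h12 : n₁ ≤ n₂) (hk : k + Y.Pw ≤ n₁) : nForced Y e n₁ n₂ k = 0 := by
  have : ∀ k, k + Y.Pw ≤ n₁ → nForced Y e n₁ n₂ k = 0 := by
    intro k
    induction k with
    | zero => intro; simp
    | succ k ih =>
      intro hk'
      rw [nForced_succ, ih (by omega)]
      have : trunkForce Y e n₁ n₂ k = 0 := by
        unfold trunkForce; simp only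
        rw [if_neg (by omega), if_neg (by omega), if_neg (by omega), if_neg (by omega)]
      simp [this]
  exact this k hk

end Counts

end BGNd

end Literature.Probability.Percolation

end
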